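import Literature.Algebra.EuclideanLattices.GapCVPCoNPSample
import Literature.LinearAlgebra.Matrix.IntegerGramCertificate
import HarnessLib

/-!
# Completeness of the integer coNP certificate for `GapCVP_{c√n}`: discharge of `FarCert.complete`

Topic `Algebra/EuclideanLattices` (family `pqc`), continuing `GapCVPCoNPWitness.lean` (the integer
far-ness certificate `FarCert` for Aharonov–Regev 2005, Thm. 1.1, coNP part; soundness proved there),
`GapCVPCoNPComplete.lean` (`complete_of : sample_exists → psd_cert_exists → complete`),
`GapCVPCoNPSample.lean` (`sample_exists_strong`: good dual samples with a `1/100` margin in the moment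
clause, PROVED) and `LinearAlgebra/Matrix/IntegerGramCertificate.lean` (`exists_gram_cert_of_margin`:
exact Gram certificates `σ² Q = RᵀR` of polynomial size for integer matrices with a
positive-definiteness margin, PROVED). Everything here is PROVED; the main result is

* `FarCert.complete_holds : FarCert.complete` — every NO instance `((B, t), d)` of `GapCVP_{200√n}`
  has an accepted certificate `⟨N, A, adj B, det B, m, R, σ⟩` of bit size polynomial in the code
  length.

The margin replaces the margin-free named fact `psd_cert_exists` (exact Gaussian elimination,
Schrijver 1986, Thm. 3.3), which is thereby bypassed: by `sample_exists_strong` the moment matrix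
`Q = N den² BBᵀ − 20000 num² AᵀA` satisfies `100 uᵀQu ≥ N den² ‖uB‖² ≥ ‖uB‖²`, and
`‖u‖² ≤ n² ‖adj B‖_∞² ‖uB‖²` (`dotProduct_self_le_of_adjugate`: `det B · u = (uB) adj B`,
Cauchy–Schwarz, `|det B| ≥ 1`), so `uᵀQu ≥ 2^{-K}‖u‖²` with `K = 4L² + 4L + 11`
(`|adj B| ≤ n!(2^L)ⁿ < 2^{2L²+L+2}`).

Consequence: with soundness (`not_accepts_of_yes`), the NP part (`gapSVP_mem_promiseNP_holds`) and
Lemma A.1 (`AharonovRegev2005_lemmaA1_holds`) proved, the vendored Cor. 1.2,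
`gapSVP_sqrt_mem_promiseNP_inter_promiseCoNP`, is conditional on exactly ONE named fact, the
verifier machine `FarCert.verifier_mem_P` ("it is easy to see that the verifier can be implemented
in polynomial time", AR05 p. 10): `gapSVP_sqrt_mem_promiseNP_inter_promiseCoNP_of_verifier`.

## References

* D. Aharonov, O. Regev, *Lattice problems in NP ∩ coNP*, J. ACM 52 (2005) 749–765, Thm. 1.1 and
  §6.2 (completeness of the verifier), Cor. 1.2.
* D. Micciancio, S. Goldwasser, *Complexity of Lattice Problems*, Kluwer 2002, Ch. 1 §1.3 (sizes).
-/

noncomputable section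

open Computability Literature.Computability.Complexity Literature.Computability.Complexity.Nondeterministic
open Matrix Polynomial Literature.LinearAlgebra.Matrix

namespace Literature.Algebra.EuclideanLattices

namespace FarCert

/-! ### The margin: `‖u‖² ≤ n² ‖adj B‖²_∞ ‖u B‖²` -/

/-- For a nonsingular integer matrix `B` with `|adj B| ≤ M` entrywise,
`‖u‖² ≤ n² M² ‖u B‖²` for every real `u` (`det B · u = (u B) · adj B`, Cauchy–Schwarz, `|det B| ≥ 1`).
[folklore] -/
theorem dotProduct_self_le_of_adjugate {n : ℕ} (B : Matrix (Fin n) (Fin n) ℤ) (hdet : B.det ≠ 0) {M : ℕ}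
    (hM : ∀ i k, (B.adjugate i k).natAbs ≤ M) (u : Fin n → ℝ) :
    u ⬝ᵥ u ≤ (n : ℝ) ^ 2 * (M : ℝ) ^ 2 * ((u ᵥ* B.map (Int.cast : ℤ → ℝ)) ⬝ᵥ (u ᵥ* B.map (Int.cast : ℤ → ℝ))) := by
  set Br : Matrix (Fin n) (Fin n) ℝ := B.map (Int.cast : ℤ → ℝ) with hBr
  set v := u ᵥ* Br with hv
  -- `det B • u = v · adj Br`, `adj Br = (adj B).map cast`, `det Br = det B`
  have hmapB : Br = (Int.castRingHom ℝ).mapMatrix B := by rw [RingHom.mapMatrix_apply, hBr]; rfl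
  have hadjmap : Br.adjugate = B.adjugate.map (Int.cast : ℤ → ℝ) := by
    rw [hmapB, ← RingHom.map_adjugate, RingHom.mapMatrix_apply]; rfl
  have hdetmap : Br.det = (B.det : ℝ) := by
    rw [hmapB, ← RingHom.map_det]; rfl
  have hvadj : v ᵥ* Br.adjugate = (B.det : ℝ) • u := by
    rw [hv, Matrix.vecMul_vecMul, Matrix.mul_adjugate, Matrix.vecMul_smul, Matrix.vecMul_one, hdetmap]
  have hk : ∀ k, (B.det : ℝ) * u k = ∑ l, v l * (B.adjugate l k : ℝ) := by
    intro k
    have e := congrFun hvadj k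
    rw [Pi.smul_apply, smul_eq_mul, Matrix.vecMul, dotProduct] at e
    rw [← e]
    refine Finset.sum_congr rfl fun l _ => ?_
    rw [hadjmap, Matrix.map_apply]
  -- Cauchy–Schwarz per coordinate
  have hadjR : ∀ l k, ((B.adjugate l k : ℝ)) ^ 2 ≤ (M : ℝ) ^ 2 := by
    intro l k
    have h1 : |(B.adjugate l k : ℝ)| ≤ M := by
      rw [← Int.cast_abs, Int.abs_eq_natAbs]; exact_mod_cast hM l k
    rw [← sq_abs]
    exact pow_le_pow_left₀ (abs_nonneg _) h1 2
  have hvv : 0 ≤ v ⬝ᵥ v := Finset.sum_nonneg fun i _ => mul_self_nonneg _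
  have hcoord : ∀ k, (B.det : ℝ) ^ 2 * (u k * u k) ≤ (v ⬝ᵥ v) * (n * (M : ℝ) ^ 2) := by
    intro k
    have hcs := Finset.sum_mul_sq_le_sq_mul_sq Finset.univ v (fun l => (B.adjugate l k : ℝ))
    have h1 : ((B.det : ℝ) * u k) ^ 2 = (∑ l, v l * (B.adjugate l k : ℝ)) ^ 2 := by rw [hk k]
    have h2 : ∑ l, ((B.adjugate l k : ℝ)) ^ 2 ≤ n * (M : ℝ) ^ 2 := by
      calc ∑ l, ((B.adjugate l k : ℝ)) ^ 2 ≤ ∑ _l : Fin n, (M : ℝ) ^ 2 := Finset.sum_le_sum fun l _ => hadjR l k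
        _ = n * (M : ℝ) ^ 2 := by simp
    have h3 : ∑ l, v l ^ 2 = v ⬝ᵥ v := by rw [dotProduct]; exact Finset.sum_congr rfl fun l _ => sq _
    calc (B.det : ℝ) ^ 2 * (u k * u k) = ((B.det : ℝ) * u k) ^ 2 := by ring
      _ = (∑ l, v l * (B.adjugate l k : ℝ)) ^ 2 := h1
      _ ≤ (∑ l, v l ^ 2) * ∑ l, ((B.adjugate l k : ℝ)) ^ 2 := hcs
      _ ≤ (v ⬝ᵥ v) * (n * (M : ℝ) ^ 2) := by rw [h3]; exact mul_le_mul_of_nonneg_left h2 hvv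
  have hsum : (B.det : ℝ) ^ 2 * (u ⬝ᵥ u) ≤ (n : ℝ) ^ 2 * (M : ℝ) ^ 2 * (v ⬝ᵥ v) := by
    rw [dotProduct, Finset.mul_sum]
    calc ∑ k, (B.det : ℝ) ^ 2 * (u k * u k) ≤ ∑ _k : Fin n, (v ⬝ᵥ v) * (n * (M : ℝ) ^ 2) :=
          Finset.sum_le_sum fun k _ => hcoord k
      _ = (n : ℝ) ^ 2 * (M : ℝ) ^ 2 * (v ⬝ᵥ v) := by simp; ring
  have hdet1 : (1 : ℝ) ≤ (B.det : ℝ) ^ 2 := by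
    have h1 : (1 : ℤ) ≤ |B.det| := Int.one_le_abs hdet
    have h2 : (1 : ℝ) ≤ |(B.det : ℝ)| := by rw [← Int.cast_abs]; exact_mod_cast h1
    nlinarith [sq_abs (B.det : ℝ)]
  have huu : 0 ≤ u ⬝ᵥ u := Finset.sum_nonneg fun i _ => mul_self_nonneg _
  calc u ⬝ᵥ u ≤ (B.det : ℝ) ^ 2 * (u ⬝ᵥ u) := le_mul_of_one_le_left huu hdet1
    _ ≤ (n : ℝ) ^ 2 * (M : ℝ) ^ 2 * (v ⬝ᵥ v) := hsum

/-- The far count never exceeds the number of samples. [folklore] -/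
theorem farCountOf_le {N n : ℕ} (A : Matrix (Fin N) (Fin n) ℤ) (C : Matrix (Fin n) (Fin n) ℤ) (δ : ℤ) (t : Fin n → ℤ) :
    farCountOf A C δ t ≤ N := by
  unfold farCountOf
  exact (Finset.card_filter_le _ _).trans (by simp)

/-- The size polynomial of the Gram certificate, `V(L) = 9 (L + K + S) + 20` with `K = 4L² + 4L + 11`,
`S = 3 q(L) L + 5L + 16`, `q = samplePoly`. [folklore] -/
def certSizePoly : Polynomial ℕ :=
  9 * (X + (4 * X ^ 2 + 4 * X + 11) + (3 * (samplePoly * X) + 5 * X + 16)) + 20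

/-- Evaluation of `certSizePoly`. [folklore] -/
theorem certSizePoly_eval (L : ℕ) :
    certSizePoly.eval L = 9 * (L + (4 * L ^ 2 + 4 * L + 11) + (3 * (samplePoly.eval L * L) + 5 * L + 16)) + 20 := by
  simp [certSizePoly]

/-- The total bit-size polynomial of the certificate of `complete_holds`. [folklore] -/
def completePoly2 : Polynomial ℕ :=
  samplePoly * X + X ^ 2 + 5 * (X + 1) ^ 2 * X + 2 + samplePoly + 5 * (X + 1) ^ 2 +
    samplePoly * X * X * (samplePoly * X + 1) + X * (X * (2 * X ^ 2 + X + 2)) + (2 * X ^ 2 + X + 2) +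
    5 * (X + 1) ^ 2 * X * certSizePoly + certSizePoly

/-- Evaluation of `completePoly2`. [folklore] -/
theorem completePoly2_eval (L : ℕ) :
    completePoly2.eval L =
      samplePoly.eval L * L + L ^ 2 + 5 * (L + 1) ^ 2 * L + 2 + samplePoly.eval L + 5 * (L + 1) ^ 2 +
        samplePoly.eval L * L * L * (samplePoly.eval L * L + 1) + L * (L * (2 * L ^ 2 + L + 2)) + (2 * L ^ 2 + L + 2) +
        5 * (L + 1) ^ 2 * L * certSizePoly.eval L + certSizePoly.eval L := by
  simp [completePoly2]

/-- **Discharge of `FarCert.complete`** (Aharonov–Regev 2005, §6.2 — completeness of the verifier —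
for the integer certificate `FarCert`, constant `c₀ = 200`): for a NO instance of `GapCVP_{200√n}` take
`N, A` from `sample_exists_strong`, `C = adj B`, `δ = det B`, the moment matrix `Q` (symmetric,
entries `≤ 2^S`, and `uᵀQu ≥ 2^{-K}‖u‖²` by the `1/100` margin and `dotProduct_self_le_of_adjugate`),
and `(R, σ)` from `exists_gram_cert_of_margin`; the certificate `⟨N, A, adj B, det B, m, R, σ⟩` is
accepted and has bit size `≤ completePoly2 (L)`. [cite: AharonovRegev2005, §6.2 (pp. 11–12) — variant for the integer verifier] -/
theorem complete_holds : complete := by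
  refine ⟨200, by norm_num, completePoly2, ?_⟩
  rintro ⟨⟨I, t⟩, d⟩ hp
  have hI : I.IsNonsingular := hp.1
  have hd : 0 < d := hp.2.1
  obtain ⟨N, A, hN, hA, hcount, hmom⟩ := sample_exists_strong I t d hp
  obtain ⟨hnL, hsn, hsB, hsnum, hsden⟩ := sizes_le_length_encode_gapCVP I t d
  have hLpos : 0 < (gapCVPInstanceEncoding.encode ((⟨I, t⟩ : CVPInstance), d)).length := by
    rw [gapCVP_encode_fields, length_boolPair]; omega
  generalize (gapCVPInstanceEncoding.encode ((⟨I, t⟩ : CVPInstance), d)).length = L at hN hA hnL hsn hsB hsnum hsden hLpos ⊢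
  set qL := samplePoly.eval L with hqL
  -- numeric consequences of the size bounds
  have hB2 : ∀ i k, (I.basis i k).natAbs ≤ 2 ^ L := fun i k => (Nat.size_le.1 (hsB i k)).le
  have hnum2 : d.num.natAbs ≤ 2 ^ L := (Nat.size_le.1 hsnum).le
  have hden2 : d.den ≤ 2 ^ L := (Nat.size_le.1 hsden).le
  have hn2 : I.n ≤ 2 ^ L := hnL.trans Nat.lt_two_pow_self.le
  have hN2 : N ≤ 2 ^ qL := hN.trans Nat.lt_two_pow_self.le
  have hNpos : 0 < N := by
    have := farCountOf_le A I.basis.adjugate I.basis.det t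
    omega
  -- the moment matrix
  set c₁ : FarCert I.n := ⟨N, A, I.basis.adjugate, I.basis.det, 0, 0, 1⟩ with hc₁
  set Q := c₁.momentMatrix I.basis d with hQdef
  have hQt : Qᵀ = Q := momentMatrix_transpose _ _ _
  -- adjugate bound and the margin exponent
  have hmax : max (2 ^ L) 1 = 2 ^ L := max_eq_left Nat.one_le_two_pow
  have hTL : (2 ^ L).size = L + 1 := Nat.size_pow
  have hfac : (I.n.factorial * (2 ^ L) ^ I.n).size ≤ 2 * L ^ 2 + L + 2 := by
    have h0 := size_factorial_mul_pow_le I.n (2 ^ L)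
    rw [hTL] at h0
    have h1 : I.n * I.n.size ≤ L * L := Nat.mul_le_mul hnL hsn
    have h2 : I.n * (L + 1) ≤ L * (L + 1) := Nat.mul_le_mul_right _ hnL
    have h3 : L ^ 2 = L * L := sq L
    have h4 : L * (L + 1) = L * L + L := by ring
    rw [h4] at h2
    rw [h3]
    omega
  have hAdj : ∀ i k, (I.basis.adjugate i k).natAbs ≤ I.n.factorial * (2 ^ L) ^ I.n := fun i k => by
    have := natAbs_adjugate_le I.basis hB2 i k
    rwa [hmax] at this
  set Amax := I.n.factorial * (2 ^ L) ^ I.n with hAmax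
  have hAmax2 : Amax ≤ 2 ^ (2 * L ^ 2 + L + 2) :=
    (Nat.lt_size_self _).le.trans (Nat.pow_le_pow_right (by norm_num) hfac)
  set K := 4 * L ^ 2 + 4 * L + 11 with hK
  have hKnat : 100 * (I.n ^ 2 * Amax ^ 2) ≤ 2 ^ K := by
    have a1 : 100 ≤ 2 ^ 7 := by norm_num
    have a2 : I.n ^ 2 ≤ (2 ^ L) ^ 2 := Nat.pow_le_pow_left hn2 2
    have a3 : Amax ^ 2 ≤ (2 ^ (2 * L ^ 2 + L + 2)) ^ 2 := Nat.pow_le_pow_left hAmax2 2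
    calc 100 * (I.n ^ 2 * Amax ^ 2) ≤ 2 ^ 7 * ((2 ^ L) ^ 2 * (2 ^ (2 * L ^ 2 + L + 2)) ^ 2) :=
          Nat.mul_le_mul a1 (Nat.mul_le_mul a2 a3)
      _ = 2 ^ K := by rw [hK, ← pow_mul, ← pow_mul, ← pow_add, ← pow_add]; ring_nf
  have hKR : 100 * ((I.n : ℝ) ^ 2 * (Amax : ℝ) ^ 2) ≤ (2 : ℝ) ^ K := by exact_mod_cast hKnat
  -- the quadratic form: nonnegativity and margin
  have hquad : ∀ u : Fin I.n → ℝ, u ⬝ᵥ (Q.map (Int.cast : ℤ → ℝ) *ᵥ u) =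
      (N : ℝ) * (d.den : ℝ) ^ 2 * ((u ᵥ* I.basis.map (Int.cast : ℤ → ℝ)) ⬝ᵥ (u ᵥ* I.basis.map (Int.cast : ℤ → ℝ))) -
        20000 * (d.num : ℝ) ^ 2 * ((A.map (Int.cast : ℤ → ℝ) *ᵥ u) ⬝ᵥ (A.map (Int.cast : ℤ → ℝ) *ᵥ u)) := fun u => by
    rw [hQdef, cast_momentMatrix_quadForm]
  have hNden : (1 : ℝ) ≤ (N : ℝ) * (d.den : ℝ) ^ 2 := by
    have h1 : (1 : ℝ) ≤ N := by exact_mod_cast hNpos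
    have h2 : (1 : ℝ) ≤ d.den := by exact_mod_cast d.den_pos
    nlinarith
  have hmargin : ∀ u : Fin I.n → ℝ, u ⬝ᵥ u ≤ 2 ^ K * (u ⬝ᵥ (Q.map (Int.cast : ℤ → ℝ) *ᵥ u)) := by
    intro u
    have h1 := hmom u
    have h2 := dotProduct_self_le_of_adjugate I.basis hI hAdj u
    set vv := (u ᵥ* I.basis.map (Int.cast : ℤ → ℝ)) ⬝ᵥ (u ᵥ* I.basis.map (Int.cast : ℤ → ℝ)) with hvv
    set aa := (A.map (Int.cast : ℤ → ℝ) *ᵥ u) ⬝ᵥ (A.map (Int.cast : ℤ → ℝ) *ᵥ u) with haa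
    have hvv0 : 0 ≤ vv := Finset.sum_nonneg fun i _ => mul_self_nonneg _
    have huu0 : 0 ≤ u ⬝ᵥ u := Finset.sum_nonneg fun i _ => mul_self_nonneg _
    rw [hquad u]
    -- `vv ≤ 100 · uQu`
    have h3 : vv ≤ 100 * ((N : ℝ) * (d.den : ℝ) ^ 2 * vv - 20000 * (d.num : ℝ) ^ 2 * aa) := by
      have h4 : vv ≤ (N : ℝ) * (d.den : ℝ) ^ 2 * vv := le_mul_of_one_le_left hvv0 hNden
      linarith
    have h5 : 0 ≤ (N : ℝ) * (d.den : ℝ) ^ 2 * vv - 20000 * (d.num : ℝ) ^ 2 * aa := by linarith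
    calc u ⬝ᵥ u ≤ (I.n : ℝ) ^ 2 * (Amax : ℝ) ^ 2 * vv := h2
      _ ≤ (I.n : ℝ) ^ 2 * (Amax : ℝ) ^ 2 * (100 * ((N : ℝ) * (d.den : ℝ) ^ 2 * vv - 20000 * (d.num : ℝ) ^ 2 * aa)) :=
          mul_le_mul_of_nonneg_left h3 (by positivity)
      _ = 100 * ((I.n : ℝ) ^ 2 * (Amax : ℝ) ^ 2) * ((N : ℝ) * (d.den : ℝ) ^ 2 * vv - 20000 * (d.num : ℝ) ^ 2 * aa) := by ring
      _ ≤ 2 ^ K * ((N : ℝ) * (d.den : ℝ) ^ 2 * vv - 20000 * (d.num : ℝ) ^ 2 * aa) :=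
          mul_le_mul_of_nonneg_right hKR h5
  -- entries of `Q`
  set S := 3 * (qL * L) + 5 * L + 16 with hS
  have hQS : ∀ i k, (Q i k).natAbs ≤ 2 ^ S := by
    intro i k
    refine (natAbs_momentMatrix_le c₁ I.basis d hB2 hA i k).trans ?_
    change N * d.den ^ 2 * (I.n * (2 ^ L) ^ 2) + 20000 * d.num.natAbs ^ 2 * (N * (2 ^ qL) ^ 2) ≤ 2 ^ S
    have e1 : N * d.den ^ 2 * (I.n * (2 ^ L) ^ 2) ≤ 2 ^ qL * (2 ^ L) ^ 2 * (2 ^ L * (2 ^ L) ^ 2) :=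
      Nat.mul_le_mul (Nat.mul_le_mul hN2 (Nat.pow_le_pow_left hden2 2)) (Nat.mul_le_mul_right _ hn2)
    have e2 : 20000 * d.num.natAbs ^ 2 * (N * (2 ^ qL) ^ 2) ≤ 2 ^ 15 * (2 ^ L) ^ 2 * (2 ^ qL * (2 ^ qL) ^ 2) :=
      Nat.mul_le_mul (Nat.mul_le_mul (by norm_num) (Nat.pow_le_pow_left hnum2 2)) (Nat.mul_le_mul_right _ hN2)
    have p1 : 2 ^ qL * (2 ^ L) ^ 2 * (2 ^ L * (2 ^ L) ^ 2) = 2 ^ (qL + 5 * L) := by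
      rw [← pow_mul, ← pow_add, ← pow_add, ← pow_add]; ring_nf
    have p2 : 2 ^ 15 * (2 ^ L) ^ 2 * (2 ^ qL * (2 ^ qL) ^ 2) = 2 ^ (15 + 2 * L + 3 * qL) := by
      rw [← pow_mul, ← pow_mul, ← pow_add, ← pow_add, ← pow_add]; ring_nf
    rw [p1] at e1
    rw [p2] at e2
    have hqL1 : qL ≤ qL * L := Nat.le_mul_of_pos_right _ hLpos
    have f1 : 2 ^ (qL + 5 * L) ≤ 2 ^ (S - 1) := Nat.pow_le_pow_right (by norm_num) (by omega)
    have f2 : 2 ^ (15 + 2 * L + 3 * qL) ≤ 2 ^ (S - 1) := Nat.pow_le_pow_right (by norm_num) (by omega)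
    have hS1 : S - 1 + 1 = S := by omega
    have f3 : 2 ^ (S - 1) + 2 ^ (S - 1) = 2 ^ S := by
      rw [← two_mul, ← pow_succ', hS1]
    omega
  -- the Gram certificate
  obtain ⟨m, R, σ, hσ, hRR, hm, hσs, hRs⟩ := exists_gram_cert_of_margin I.n K S Q hQt hmargin hQS
  set cert : FarCert I.n := ⟨N, A, I.basis.adjugate, I.basis.det, m, R, σ⟩ with hcert_def
  have hmm : cert.momentMatrix I.basis d = Q := rfl
  have hacc : cert.Accepts ((⟨I, t⟩ : CVPInstance), d) := by
    refine ⟨hI, ?_, ?_, hσ, ?_, ?_⟩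
    · exact Matrix.adjugate_mul I.basis
    · exact Matrix.mul_adjugate I.basis
    · change ((cert.σ : ℤ) ^ 2) • cert.momentMatrix I.basis d = cert.Rᵀ * cert.R
      rw [hmm]; exact hRR
    · change cert.N < 4 * cert.farCount t
      rw [hcert_def, farCount_mk]; exact hcount
  refine ⟨cert, hacc, ?_⟩
  -- the bit size
  have hV : 9 * (I.n + K + S) + 20 ≤ certSizePoly.eval L := by
    rw [certSizePoly_eval, ← hqL, hK, hS]; omega
  set V := certSizePoly.eval L with hVdef
  have sA : ∀ j k, (A j k).natAbs.size ≤ qL + 1 := fun j k =>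
    (Nat.size_le_size (hA j k)).trans (by rw [Nat.size_pow])
  have sAdj : ∀ i k, (I.basis.adjugate i k).natAbs.size ≤ 2 * L ^ 2 + L + 2 := fun i k =>
    (Nat.size_le_size (hAdj i k)).trans hfac
  have sDet : I.basis.det.natAbs.size ≤ 2 * L ^ 2 + L + 2 :=
    (Nat.size_le_size (natAbs_det_le_of_entries I.basis hB2)).trans hfac
  have sR : ∀ i k, (R i k).natAbs.size ≤ V := fun i k => (hRs i k).trans hV
  have sσ : σ.size ≤ V := hσs.trans hV
  have sumA : ∑ j, ∑ k, (A j k).natAbs.size ≤ N * (I.n * (qL + 1)) :=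
    sum_sum_le_mul_mul (fun j k => (A j k).natAbs.size) sA
  have sumC : ∑ i, ∑ k, (I.basis.adjugate i k).natAbs.size ≤ I.n * (I.n * (2 * L ^ 2 + L + 2)) :=
    sum_sum_le_mul_mul (fun i k => (I.basis.adjugate i k).natAbs.size) sAdj
  have sumR : ∑ i, ∑ k, (R i k).natAbs.size ≤ m * (I.n * V) :=
    sum_sum_le_mul_mul (fun i k => (R i k).natAbs.size) sR
  rw [hcert_def]
  change N * I.n + I.n * I.n + m * I.n + 2 + N + m + (∑ j, ∑ k, (A j k).natAbs.size) +
      (∑ i, ∑ k, (I.basis.adjugate i k).natAbs.size) + I.basis.det.natAbs.size +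
      (∑ i, ∑ k, (R i k).natAbs.size) + σ.size ≤ completePoly2.eval L
  rw [completePoly2_eval, ← hqL, ← hVdef]
  have hm' : m ≤ 5 * (L + 1) ^ 2 := hm.trans (Nat.mul_le_mul_left 5 (Nat.pow_le_pow_left (by omega) 2))
  have t1 : N * I.n ≤ qL * L := Nat.mul_le_mul hN hnL
  have t2 : I.n * I.n ≤ L ^ 2 := by rw [sq]; exact Nat.mul_le_mul hnL hnL
  have t3 : m * I.n ≤ 5 * (L + 1) ^ 2 * L := Nat.mul_le_mul hm' hnL
  have hqL1 : qL ≤ qL * L := Nat.le_mul_of_pos_right _ hLpos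
  have t6 : N * (I.n * (qL + 1)) ≤ qL * L * L * (qL * L + 1) := by
    have a1 : N * (I.n * (qL + 1)) ≤ qL * (L * (qL + 1)) := Nat.mul_le_mul hN (Nat.mul_le_mul_right _ hnL)
    have a3 : L * (qL + 1) ≤ L * (L * (qL * L + 1)) := by
      refine Nat.mul_le_mul_left L ?_
      have e : L * (qL * L + 1) = qL * L * L + L := by ring
      rw [e]
      have : qL * L ≤ qL * L * L := Nat.le_mul_of_pos_right _ hLpos
      omega
    calc N * (I.n * (qL + 1)) ≤ qL * (L * (qL + 1)) := a1
      _ ≤ qL * (L * (L * (qL * L + 1))) := Nat.mul_le_mul_left _ a3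
      _ = qL * L * L * (qL * L + 1) := by ring
  have t7 : I.n * (I.n * (2 * L ^ 2 + L + 2)) ≤ L * (L * (2 * L ^ 2 + L + 2)) :=
    Nat.mul_le_mul hnL (Nat.mul_le_mul_right _ hnL)
  have t8 : m * (I.n * V) ≤ 5 * (L + 1) ^ 2 * L * V := by
    calc m * (I.n * V) ≤ (5 * (L + 1) ^ 2) * (L * V) := Nat.mul_le_mul hm' (Nat.mul_le_mul_right _ hnL)
      _ = 5 * (L + 1) ^ 2 * L * V := by ring
  linarith

end FarCert

/-! ### Consequences -/

/-- **Aharonov–Regev 2005, Thm. 1.1, coNP part — from the machine alone**: soundness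
(`not_accepts_of_yes`) and completeness (`FarCert.complete_holds`) of the integer certificate being
proved, `GapCVP_{c√n} ∈ PromiseCoNP` follows from the polynomial-time verifier `FarCert.verifier_mem_P`.
[cite: AharonovRegev2005, Thm. 1.1 (p. 2) and §6] -/
theorem gapCVP_sqrt_mem_promiseCoNP_of_verifier (hV : FarCert.verifier_mem_P) : gapCVP_sqrt_mem_promiseCoNP :=
  gapCVP_sqrt_mem_promiseCoNP_of hV FarCert.complete_holds

/-- **Aharonov–Regev 2005, Cor. 1.2 — conditional on the verifier machine only**: the vendored fact
`gapSVP_sqrt_mem_promiseNP_inter_promiseCoNP` (`GapSVP_{c√n} ∈ PromiseNP ∩ PromiseCoNP`) from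
`FarCert.verifier_mem_P` (AR05 p. 10: "It is easy to see that the verifier can be implemented in
polynomial time"), everything else — the NP verifier, Lemma A.1, soundness (§6.1), the sampling
(§6.2) and the exact PSD certificate — being proved in the tree.
[cite: AharonovRegev2005, Cor. 1.2 (p. 2), from Thm. 1.1 and Lemma A.1 (p. 14)] -/
theorem gapSVP_sqrt_mem_promiseNP_inter_promiseCoNP_of_verifier (hV : FarCert.verifier_mem_P) :
    gapSVP_sqrt_mem_promiseNP_inter_promiseCoNP :=
  gapSVP_sqrt_mem_promiseNP_inter_promiseCoNP_of_NP_of_coNP gapSVP_mem_promiseNP_holds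
    (gapCVP_sqrt_mem_promiseCoNP_of_verifier hV)

end Literature.Algebra.EuclideanLattices

end
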